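import Literature.Geometry.Lorentzian.KerrConvergenceProofs
import Literature.Geometry.Lorentzian.KerrData
import HarnessLib

/-!
# Homogeneity of the Kerr–Schild chart under `(M, a, x) ↦ (λM, λa, λx)`

The Kerr family is a one-parameter family of HOMOTHETIC geometries: in Kerr–Schild Cartesian
coordinates the metric components are functions of `(M/r, a/r, x/r)` only, so that
`g_{λM, λa}(λ x) = g_{M, a}(x)` as bilinear forms on `ℝ⁴` (`λ > 0`), i.e. the dilation
`D_λ : x ↦ λ x` is a homothety `D_λ^* g_{λM,λa} = λ² g_{M,a}` of ratio `λ` from Kerr(`M, a`) onto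
Kerr(`λM, λa`) (Kerr–Schild 1965, §2; Visser arXiv:0706.0622, (32)–(35): `H = M r³/(r⁴ + a²z²)`,
`ℓ = (1, (rx + ay)/(r² + a²), (ry − ax)/(r² + a²), z/r)` are homogeneous of degree `0`, the
radius `r` of degree `1`). The tree already has the degree-`1`/`0` scalings `Kerr.radius_smul`,
`Kerr.scalarH_smul`, `Kerr.nullCovector_smul` (`KerrConvergenceProofs.lean`, written for the
small-mass limit `ε M`); this file records the consequences used to RESCALE Kerr-shielded
initial data (a body glued to an exact Kerr end, dilated by `λ`):

* `scalarH_dilate` — `H_{λM,λa}(λx) = H_{M,a}(x)`; `bilin_dilate` — `g_{λM,λa}(λx) = g_{M,a}(x)`;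
  `nullVector_dilate`, `timeVector_dilate` — `ℓ♯` and the time-orientation field
  `V = −g♯dt*` are dilation invariant;
* `rPlus_dilate`, `rMinus_dilate` — `r± (λM, λa) = λ r±(M, a)` (`λ ≥ 0`);
* `mem_region_dilate_iff`, `mem_slice_dilate_iff` — `λ x ∈ Kerr.region (λa) (λr₀) ↔
  x ∈ Kerr.region a r₀`, and the same for the slices `Kerr.slice`;
* `smoothMetric_val_dilate` — the value of `Kerr.smoothMetric (λM) (λa) (λr₀)` at the dilated
  point is the value of `Kerr.smoothMetric M a r₀` at the original point.

Everything is proved; no definitions, no named facts.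

## References

* R. P. Kerr, A. Schild, *A new class of vacuum solutions of the Einstein field equations*
  (1965), §2. [KerrSchild1965]
* M. Visser, *The Kerr spacetime: a brief introduction*, arXiv:0706.0622, (32)–(35). [arXiv07060622]
-/

noncomputable section

open scoped Manifold ContDiff Topology

namespace Literature.Geometry.Lorentzian

namespace Kerr

variable {lam : ℝ}

/-- `H` is linear in the mass parameter: `H_{M,a} = M · H_{1,a}`. [cite: arXiv07060622, (33)] -/
theorem scalarH_eq_mul_scalarH_one (M a : ℝ) (x : E4) : scalarH M a x = M * scalarH 1 a x := by
  unfold scalarH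
  ring

/-- **`H` is dilation invariant**: `H_{λM,λa}(λx) = H_{M,a}(x)` for `λ > 0`. [cite: arXiv07060622, (33)] -/
theorem scalarH_dilate (hlam : 0 < lam) (M a : ℝ) (x : E4) :
    scalarH (lam * M) (lam * a) (lam • x) = scalarH M a x := by
  rw [scalarH_eq_mul_scalarH_one (lam * M), scalarH_smul hlam M a x]

/-- **The Kerr–Schild metric is dilation invariant in Cartesian components**:
`g_{λM,λa}(λx) = g_{M,a}(x)` for `λ > 0`. [cite: KerrSchild1965, §2] -/
theorem bilin_dilate (hlam : 0 < lam) (M a : ℝ) (x : E4) :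
    bilin (lam * M) (lam * a) (lam • x) = bilin M a x := by
  unfold bilin
  rw [scalarH_dilate hlam, nullCovector_smul hlam]

/-- `ℓ♯` is dilation invariant. [cite: arXiv07060622, (34)] -/
theorem nullVector_dilate (hlam : 0 < lam) (a : ℝ) (x : E4) :
    nullVector (lam * a) (lam • x) = nullVector a x := by
  unfold nullVector
  rw [nullCovectorFun_smul hlam]

/-- **The time-orientation field `V = −g♯dt*` is dilation invariant.** [cite: arXiv08110354] -/
theorem timeVector_dilate (hlam : 0 < lam) (M a : ℝ) (x : E4) :
    timeVector (lam * M) (lam * a) (lam • x) = timeVector M a x := by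
  unfold timeVector
  rw [scalarH_dilate hlam, nullVector_dilate hlam]

/-- `√((λM)² − (λa)²) = λ √(M² − a²)` for `λ ≥ 0`. [folklore] -/
theorem sqrt_sq_sub_sq_dilate (hlam : 0 ≤ lam) (M a : ℝ) :
    Real.sqrt ((lam * M) ^ 2 - (lam * a) ^ 2) = lam * Real.sqrt (M ^ 2 - a ^ 2) := by
  rw [show (lam * M) ^ 2 - (lam * a) ^ 2 = lam ^ 2 * (M ^ 2 - a ^ 2) by ring,
    Real.sqrt_mul (sq_nonneg lam) _, Real.sqrt_sq hlam]

/-- **`r₊(λM, λa) = λ r₊(M, a)`** for `λ ≥ 0`. [cite: ONeill1995, Ch. 2  §2.3] -/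
theorem rPlus_dilate (hlam : 0 ≤ lam) (M a : ℝ) : rPlus (lam * M) (lam * a) = lam * rPlus M a := by
  unfold rPlus
  rw [sqrt_sq_sub_sq_dilate hlam]
  ring

/-- **`r₋(λM, λa) = λ r₋(M, a)`** for `λ ≥ 0`. [cite: ONeill1995, Ch. 2  §2.3] -/
theorem rMinus_dilate (hlam : 0 ≤ lam) (M a : ℝ) : rMinus (lam * M) (lam * a) = lam * rMinus M a := by
  unfold rMinus
  rw [sqrt_sq_sub_sq_dilate hlam]
  ring

/-- `max (λ r₀) 0 = λ max r₀ 0` for `λ ≥ 0`. [folklore] -/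
theorem max_mul_zero (hlam : 0 ≤ lam) (r₀ : ℝ) : max (lam * r₀) 0 = lam * max r₀ 0 := by
  rcases le_total r₀ 0 with h | h
  · rw [max_eq_right h, mul_zero, max_eq_right (mul_nonpos_of_nonneg_of_nonpos hlam h)]
  · rw [max_eq_left h, max_eq_left (mul_nonneg hlam h)]

/-- **The Kerr–Schild regions are dilation covariant**: `λx ∈ region (λa) (λr₀) ↔ x ∈ region a r₀`
(`λ > 0`). [cite: arXiv08110354] -/
theorem mem_region_dilate_iff (hlam : 0 < lam) {a r₀ : ℝ} {x : E4} :
    lam • x ∈ region (lam * a) (lam * r₀) ↔ x ∈ region a r₀ := by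
  rw [mem_region, mem_region, radius_smul hlam, max_mul_zero hlam.le]
  exact mul_lt_mul_iff_of_pos_left hlam

/-- `(λ • ofTimeSpace t y) = ofTimeSpace (λ t) (λ • y)`. [folklore] -/
theorem smul_ofTimeSpace (lam t : ℝ) (y : E3) : lam • E4.ofTimeSpace t y = E4.ofTimeSpace (lam * t) (lam • y) := by
  ext i
  refine Fin.cases ?_ (fun j ↦ ?_) i
  · simp [E4.ofTimeSpace]
  · simp [E4.ofTimeSpace, Matrix.vecCons]

/-- **The Kerr–Schild slices are dilation covariant**: `λy ∈ slice (λa) (λr₀) ↔ y ∈ slice a r₀`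
(`λ > 0`). [cite: arXiv08110354] -/
theorem mem_slice_dilate_iff (hlam : 0 < lam) {a r₀ : ℝ} {y : E3} :
    lam • y ∈ slice (lam * a) (lam * r₀) ↔ y ∈ slice a r₀ := by
  rw [mem_slice_iff_ofTimeSpace_mem_region, mem_slice_iff_ofTimeSpace_mem_region,
    ← mem_region_dilate_iff hlam (x := E4.ofTimeSpace 0 y), smul_ofTimeSpace, mul_zero]

/-- **The smooth Kerr metric at the dilated point**: for `x ∈ region a r₀`,
`(Kerr.smoothMetric (λM) (λa) (λr₀)).val ⟨λx, _⟩ = (Kerr.smoothMetric M a r₀).val ⟨x, _⟩` as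
bilinear forms on `ℝ⁴` (`λ > 0`). [cite: KerrSchild1965, §2] -/
theorem smoothMetric_val_dilate [Facts] (hlam : 0 < lam) (M a r₀ : ℝ) (x : region a r₀) :
    (smoothMetric (lam * M) (lam * a) (lam * r₀)).val
        ⟨lam • (x : E4), (mem_region_dilate_iff hlam).2 x.2⟩ =
      (smoothMetric M a r₀).val x := by
  rw [smoothMetric_val, smoothMetric_val]
  exact bilin_dilate hlam M a x

end Kerr

end Literature.Geometry.Lorentzian

end
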